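import Summits.AtomisticToContinuum.HydrodynamicLimit.Theorems.MourreKoopmanChargesLinearToEntropyInBandWindowClauseExponent
import Literature.MathematicalPhysics.KineticTheory.HardSphereEulerPrimitiveForm
import Literature.Analysis.FunctionSpaces.TorusSpaceTime
import HarnessLib

/-!
# Route `MourreKoopmanCharges`, crux `LinearToEntropyInBand` (stmt-AtomisticToContinuum-17740), skeleton v8:
# stub 4a-ii, the Euler structure of the entropy variables, part A (`∂ₜλ = −DF(U)ᵀ∇λ`, plan § 1 D)

Support file (`--supports stmt-AtomisticToContinuum-17740`; registered helper `stub_windowClauseEulerStructure`; worker of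
lead prover-line-…-17740-c5-0, wave 5; plan `work/stubs/WINDOWCLAUSE-PLAN.md` § 1 D, § 3 "Euler structure").  Part B
(`…WindowClauseEulerDefect`) holds the 1-homogeneity defect (the `Cst` slot) and the Euler-state reading of `visFluxN`.

The block Euler remainder of the chain of stub 4a-ii combines `∫ Σᵢ ∂ₜλ_s(xᵢ)·η(vᵢ) dr` (the `∂ₜ`-part of the streaming
rate of the local-Gibbs exponent, `η(v) = (1, v, ‖v‖²/2)`) with `−∫ visFluxN(∇λ_s) dr` (the tested Euler flux of the
visible block fields).  Here: the ENTROPY-VARIABLE (symmetric-hyperbolic) STRUCTURE of the hs-Euler system, coefficient-wise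
— `eulerStructure_entropyVariables`: `∂ₜλ·δU + Σ_k ∂_kλ·DF^k(U)δU = 0` for EVERY conserved increment `δU`, i.e.
`∂ₜλ = −Σ_k (DF^k)ᵀ ∂_kλ`, for the explicit reference activity `a = ρ Rf(σ³ρ)` of `WindowClauseInBand` under the
hypotheses of S8 `EulerCancellation` (EOS window `Z = 1 + ηF′`, S4 relation `(log Rf)′ = 2F′ + ηF″`) plus smoothness of
`Rf` on the window (§ 0 `contDiffOn_of_hasFPowerSeriesOnBall` docks the `(r, Rf)` prefix: `hana`, and `η₁ ≤ r` of
`ClampedCurrentsDockHeart.eosBridge`); `timeDeriv_gExp_eq_affine` splits `∂ₜ g(·, x, v)` along `(1, v, ‖v‖²/2)` and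
`timeDeriv_gExp_eq_neg_linearisedFlux` is the per-particle form `∂ₜ g_t(x, v) = −∇λ_t(x) : DF(U_t(x)) η(v)` — "S8 read
coefficient-wise in `v`".  S8 itself is not invoked: its statement fixes the direction `η(v)` and mixes the `∂ₜ`- and
`v·∇`-parts, whereas the block remainder needs `DF(U)δU` at an ARBITRARY increment (the smoothed empirical fields), so the
identity is proved from the primitive equations directly — the polynomial identity
`HydroLimitInBandClock.hsEuler_entropyVariable_identity` of the sibling clock, in conserved increments, docked to the torus
calculus (with M2 `kineticPart_gExp_eq_visKin_summand` for the `v·∇`-part it re-derives S8).  The linearised flux is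
written out in `let`s — `F(U) = (m, m⊗m/ρ + pI, (E + p)m/ρ)`, `p = (2/3)(E − ‖m‖²/(2ρ)) Z(ρσ³)`, at
`U = (ρ, ρu, ρ(‖u‖²/2 + 3θ/2))`: `δu = (δm − uδρ)/ρ`, `δp = (2/3)Z(δE − u·δm + ‖u‖²δρ/2) + θ(ρσ³)Z′δρ`, `δF⁰_k = δm_k`,
`δFᵐ_{kj} = u_jδm_k + u_kδm_j − u_ku_jδρ + δ_{kj}δp`, `δFᵉ_k = (E + p)δu_k + u_k(δE + δp)` — manifestly linear in `δU`.
Nothing here restates the crux, a stub, a neighbour's stub or the Statement.  References: H.-T. Yau, Lett. Math. Phys. 22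
(1991) § 2; S. Olla, S. R. S. Varadhan, H.-T. Yau, Commun. Math. Phys. 155 (1993) § 3; C. M. Dafermos, *Hyperbolic
Conservation Laws in Continuum Physics* (2005) §§ 1.5, 3.2 (entropy variables symmetrise the system).
-/

noncomputable section

open MeasureTheory Filter Set
open scoped ENNReal Topology InnerProductSpace BigOperators

namespace Summit.AtomisticToContinuum.HydrodynamicLimit.Theorems.LTEInBand

open Literature.MathematicalPhysics.KineticTheory Literature.Analysis.FluidPDE Literature.Analysis.FunctionSpaces
open Literature.MathematicalPhysics.KineticTheory.HsEulerCalc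

/-! ## § 0 Docking the `(r, Rf)` prefix: the insertion factor is smooth on the EOS window -/

/-- An insertion factor with a power series at `0` of radius `r` is smooth on every window `(0, η₁)`, `η₁ ≤ r` (the
`hRfs` hypothesis of § 1 from the `hana` hypothesis of `WindowClauseInBand` and `η₁ ≤ r` of `eosBridge`). -/
theorem contDiffOn_of_hasFPowerSeriesOnBall {r η₁ : ℝ} {Rf : ℝ → ℝ}
    (hana : ∃ p : FormalMultilinearSeries ℝ ℝ ℝ, HasFPowerSeriesOnBall Rf p 0 (ENNReal.ofReal r)) (hη₁r : η₁ ≤ r) :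
    ContDiffOn ℝ (⊤ : ℕ∞) Rf (Ioo 0 η₁) := by
  obtain ⟨p, hp⟩ := hana
  have h1 : AnalyticOnNhd ℝ Rf (Metric.eball (0 : ℝ) (ENNReal.ofReal r)) := fun y hy => hp.analyticAt_of_mem hy
  refine ((h1.contDiffOn_of_completeSpace (n := ⊤)).of_le le_top).mono fun y hy => ?_
  rw [Metric.mem_eball, edist_dist, dist_zero_right, Real.norm_eq_abs, abs_of_pos hy.1]
  exact ENNReal.ofReal_lt_ofReal_iff'.2 ⟨hy.2.trans_le hη₁r, hy.1.trans (hy.2.trans_le hη₁r)⟩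

/-! ## § 1 The Euler structure of the entropy variables -/

section EulerStructure

variable {σ T η₁ : ℝ} {ρ θ : ℝ → T3 → ℝ} {u : ℝ → T3 → V3} {F Rf : ℝ → ℝ}

/-- **The Euler structure of the entropy variables, coefficient-wise** (`∂ₜλ = −DF(U)ᵀ ∇λ`; plan § 1 D of stub 4a-ii):
along a classical hs-Euler solution inside the analyticity window of the EOS (`Z = 1 + ηF′`), with the insertion factor
of S4 (`(log Rf)′ = 2F′ + ηF″`, i.e. `1 + η (log Rf)′ = Z + ηZ′`, `Rf` smooth on the window) and the EXPLICIT reference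
activity `a_t = ρ_t Rf(σ³ρ_t)` of `WindowClauseInBand`, the entropy variables
`λ⁰ = log a − (3/2) log(2πθ) − ‖u‖²/(2θ)`, `λʲ = u_j/θ`, `λ⁴ = −θ⁻¹` satisfy, at every `(t, x) ∈ [0,T) × 𝕋³` and for
EVERY conserved increment `δU = (δρ, δm, δE)`,
`∂ₜλ⁰ δρ + Σ_j ∂ₜλʲ δm_j + ∂ₜλ⁴ δE + Σ_k [∂_kλ⁰ δF⁰_k + Σ_j ∂_kλʲ δFᵐ_{kj} + ∂_kλ⁴ δFᵉ_k] = 0`,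
where `δF = DF(U_t(x)) δU` is the derivative of the hs-Euler flux `F(U) = (m, m ⊗ m/ρ + pI, (E + p) m/ρ)`,
`p = (2/3)(E − ‖m‖²/(2ρ)) Z(ρσ³)`, at the Euler state `U = (ρ, ρu, ρ(‖u‖²/2 + 3θ/2))`, written out in the `let`s
(`δu = (δm − u δρ)/ρ`, `δp = (2/3) Z (δE − u·δm + ‖u‖² δρ/2) + θ (ρσ³) Z′ δρ`).  One-sided time derivatives within
`[0, T)` (`Torus.timeDerivWithin`), torus gradients in coordinates.  Proof: chain rule for `log(ρ Rf(σ³ρ))`, the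
primitive equations (`IsHardSphereEulerSolution.timeDeriv_density_eq` / `density_mul_timeDeriv_velocity_eq` /
`timeDeriv_temperature_eq` with `ζ(r) = Z(rσ³)`), the EOS relations, `field_simp; ring` — the polynomial identity
`HydroLimitInBandClock.hsEuler_entropyVariable_identity` of the sibling heart, in conserved increments and docked to
the torus calculus. -/
theorem eulerStructure_entropyVariables (hE : IsHardSphereEulerSolution σ T ρ u θ)
    (hF : AnalyticOnNhd ℝ F (Ioo (-η₁) η₁))
    (hZ : ∀ η ∈ Ioo 0 η₁, hsCompressibility η = 1 + η * deriv F η)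
    (hRf : ∀ η ∈ Ioo 0 η₁, 0 < Rf η ∧ DifferentiableAt ℝ (fun x => Real.log (Rf x)) η ∧
      deriv (fun x => Real.log (Rf x)) η = 2 * deriv F η + η * deriv (deriv F) η)
    (hRfs : ContDiffOn ℝ (⊤ : ℕ∞) Rf (Ioo 0 η₁))
    (hρσ : ∀ t ∈ Ico 0 T, ∀ x, ρ t x * σ ^ 3 ∈ Ioo 0 η₁) {t : ℝ} (ht : t ∈ Ico 0 T) (x : T3)
    (δρ δE : ℝ) (δm : V3) :
    (let lam0 : ℝ → T3 → ℝ := fun t' y =>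
       Real.log (ρ t' y * Rf (σ ^ 3 * ρ t' y)) - 3 / 2 * Real.log (2 * Real.pi * θ t' y) - ‖u t' y‖ ^ 2 / (2 * θ t' y)
     let lam : Fin 3 → ℝ → T3 → ℝ := fun j t' y => u t' y j / θ t' y
     let lam4 : ℝ → T3 → ℝ := fun t' y => -(θ t' y)⁻¹
     let ρ₀ : ℝ := ρ t x
     let u₀ : V3 := u t x
     let θ₀ : ℝ := θ t x
     let Z : ℝ := hsCompressibility (ρ₀ * σ ^ 3)
     let Z' : ℝ := deriv hsCompressibility (ρ₀ * σ ^ 3)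
     let p : ℝ := hsPressure σ ρ₀ θ₀
     let E : ℝ := totalEnergyDensity ρ₀ u₀ θ₀
     let δu : Fin 3 → ℝ := fun k => (δm k - u₀ k * δρ) / ρ₀
     let δp : ℝ := 2 / 3 * Z * (δE - (∑ j, u₀ j * δm j) + ‖u₀‖ ^ 2 / 2 * δρ) + θ₀ * (ρ₀ * σ ^ 3) * Z' * δρ
     let δF0 : Fin 3 → ℝ := fun k => δm k
     let δFm : Fin 3 → Fin 3 → ℝ := fun k j =>
       u₀ j * δm k + u₀ k * δm j - u₀ k * u₀ j * δρ + (if k = j then δp else 0)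
     let δFe : Fin 3 → ℝ := fun k => (E + p) * δu k + u₀ k * (δE + δp)
     Torus.timeDerivWithin (Ico 0 T) lam0 t x * δρ +
         (∑ j, Torus.timeDerivWithin (Ico 0 T) (lam j) t x * δm j) +
         Torus.timeDerivWithin (Ico 0 T) lam4 t x * δE +
       ∑ k, (Torus.gradient (lam0 t) x k * δF0 k + (∑ j, Torus.gradient (lam j t) x k * δFm k j) +
         Torus.gradient (lam4 t) x k * δFe k) = 0) := by
  dsimp only
  have hU : UniqueDiffOn ℝ (Ico (0 : ℝ) T) := uniqueDiffOn_Ico 0 T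
  -- positivity at `(t, x)` and along the slices through it
  have hθx : θ t x ≠ 0 := (hE.temperature_pos t ht x).ne'
  have hρx : ρ t x ≠ 0 := (hE.density_pos t ht x).ne'
  have hθ0 : ∀ y, θ t y ≠ 0 := fun y => (hE.temperature_pos t ht y).ne'
  have hρ0 : ∀ y, ρ t y ≠ 0 := fun y => (hE.density_pos t ht y).ne'
  have hρ0' : ∀ τ ∈ Ico 0 T, ρ τ x ≠ 0 := fun τ hτ => (hE.density_pos τ hτ x).ne'
  have h2θ0 : ∀ y, 2 * θ t y ≠ 0 := fun y => mul_ne_zero two_ne_zero (hθ0 y)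
  have h2πθ0 : ∀ y, 2 * Real.pi * θ t y ≠ 0 := fun y => (mul_pos Real.two_pi_pos (hE.temperature_pos t ht y)).ne'
  have hπ0 : Real.pi ≠ 0 := Real.pi_pos.ne'
  have hR0 : ∀ y, Rf (σ ^ 3 * ρ t y) ≠ 0 := fun y => (hRf _ (by rw [mul_comm]; exact hρσ t ht y)).1.ne'
  have hR0' : ∀ τ ∈ Ico 0 T, Rf (σ ^ 3 * ρ τ x) ≠ 0 := fun τ hτ => (hRf _ (by rw [mul_comm]; exact hρσ τ hτ x)).1.ne'
  -- the packing at `(t, x)` and the EOS data there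
  have hmem : ρ t x * σ ^ 3 ∈ Ioo 0 η₁ := hρσ t ht x
  have hmemF : ρ t x * σ ^ 3 ∈ Ioo (-η₁) η₁ := ⟨by linarith [hmem.1, hmem.2], hmem.2⟩
  obtain ⟨-, hRd, hRd'⟩ := hRf _ hmem
  have hFan : AnalyticOnNhd ℝ (fun η => 1 + η * deriv F η) (Ioo 0 η₁) := fun η hη =>
    analyticAt_const.fun_add (analyticAt_id.fun_mul (hF.deriv η ⟨by linarith [hη.1, hη.2], hη.2⟩))
  have hZs : ContDiffOn ℝ (⊤ : ℕ∞) hsCompressibility (Ioo 0 η₁) := hFan.contDiffOn_of_completeSpace.congr fun η hη => hZ η hη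
  -- the pressure law `ζ r = Z(rσ³)` on the open preimage `J` of the window
  have hJ : IsOpen ((fun r : ℝ => r * σ ^ 3) ⁻¹' Ioo 0 η₁) := isOpen_Ioo.preimage (continuous_id.mul continuous_const)
  have hζs : ContDiffOn ℝ (⊤ : ℕ∞) (fun r => hsCompressibility (r * σ ^ 3)) ((fun r : ℝ => r * σ ^ 3) ⁻¹' Ioo 0 η₁) :=
    hZs.comp (contDiff_id.mul contDiff_const).contDiffOn fun r hr => hr
  have hp : ∀ s ∈ Ico 0 T, ∀ y, hsPressure σ (ρ s y) (θ s y) =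
      ρ s y * θ s y * (fun r => hsCompressibility (r * σ ^ 3)) (ρ s y) := fun _ _ _ => rfl
  -- EOS relations at `(t, x)`: `Z = 1 + ηF′`, `Z′ = F′ + ηF″`, `ζ′(ρ) = σ³ Z′(η)`
  have hZη : hsCompressibility (ρ t x * σ ^ 3) = 1 + ρ t x * σ ^ 3 * deriv F (ρ t x * σ ^ 3) := hZ _ hmem
  have hZd : DifferentiableAt ℝ hsCompressibility (ρ t x * σ ^ 3) :=
    (hZs.differentiableOn (by simp)).differentiableAt (isOpen_Ioo.mem_nhds hmem)
  have hZ' : deriv hsCompressibility (ρ t x * σ ^ 3) =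
      deriv F (ρ t x * σ ^ 3) + ρ t x * σ ^ 3 * deriv (deriv F) (ρ t x * σ ^ 3) := by
    have h1 : hsCompressibility =ᶠ[𝓝 (ρ t x * σ ^ 3)] fun z => 1 + z * deriv F z :=
      eventuallyEq_of_mem (isOpen_Ioo.mem_nhds hmem) fun z hz => hZ z hz
    have h2 : HasDerivAt (deriv F) (deriv (deriv F) (ρ t x * σ ^ 3)) (ρ t x * σ ^ 3) :=
      (hF.deriv _ hmemF).differentiableAt.hasDerivAt
    rw [h1.deriv_eq, (((hasDerivAt_id' (ρ t x * σ ^ 3)).fun_mul h2).const_add 1).deriv]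
    ring
  have hζ' : deriv (fun r => hsCompressibility (r * σ ^ 3)) (ρ t x) =
      σ ^ 3 * deriv hsCompressibility (ρ t x * σ ^ 3) := by
    have h := hZd.hasDerivAt.comp (ρ t x) ((hasDerivAt_id' (ρ t x)).mul_const (σ ^ 3))
    rw [show (fun r => hsCompressibility (r * σ ^ 3)) = hsCompressibility ∘ fun r => r * σ ^ 3 from rfl, h.deriv]
    ring
  -- smooth slices of the basic fields and their derivatives at `x`
  have hρ1 : Torus.IsContDiff 1 (ρ t) := (hE.smooth_density.isSmooth_slice ht).isContDiff (by simp)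
  have hθs : Torus.IsSmooth (θ t) := hE.smooth_temperature.isSmooth_slice ht
  have hus : Torus.IsSmooth (u t) := hE.smooth_velocity.isSmooth_slice ht
  have hθ1 : Torus.IsContDiff 1 (θ t) := hθs.isContDiff (by simp)
  have hu1 : Torus.IsContDiff 1 (u t) := hus.isContDiff (by simp)
  have huj1 : ∀ j, Torus.IsContDiff 1 (fun y => u t y j) := fun j => isContDiff_apply_coord hu1 j
  have cρ := fun k => hasDerivAt_coordLine hρ1 x k
  have cθ := fun k => hasDerivAt_coordLine hθ1 x k
  have cu := fun k j => hasDerivAt_coordLine (huj1 j) x k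
  have sρ := hE.smooth_density.hasDerivWithinAt_slice ht x
  have sθ := hE.smooth_temperature.hasDerivWithinAt_slice ht x
  have su := fun j => (hE.smooth_velocity.apply j).hasDerivWithinAt_slice ht x
  -- the activity slice `a_t = ρ_t Rf(σ³ρ_t)` is smooth, hence so is `λ⁰_t`
  have hRa : Torus.IsSmooth (fun y => Rf (σ ^ 3 * ρ t y)) :=
    hRfs.comp_contDiff (ContDiff.mul contDiff_const (hE.smooth_density.isSmooth_slice ht)) fun v => by
      show σ ^ 3 * ρ t _ ∈ Ioo 0 η₁
      rw [mul_comm]; exact hρσ t ht _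
  have has : Torus.IsSmooth (fun y => ρ t y * Rf (σ ^ 3 * ρ t y)) := ContDiff.mul (hE.smooth_density.isSmooth_slice ht) hRa
  have ha0 : ∀ y, 0 < ρ t y * Rf (σ ^ 3 * ρ t y) := fun y =>
    mul_pos (hE.density_pos t ht y) (hRf _ (by rw [mul_comm]; exact hρσ t ht y)).1
  have hL01 : Torus.IsContDiff 1 (fun y => Real.log (ρ t y * Rf (σ ^ 3 * ρ t y)) -
      3 / 2 * Real.log (2 * Real.pi * θ t y) - ‖u t y‖ ^ 2 / (2 * θ t y)) :=
    (isSmooth_lam0 has hθs hus ha0 (hE.temperature_pos t ht)).isContDiff (by simp)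
  have hLj1 : ∀ j, Torus.IsContDiff 1 (fun y => u t y j / θ t y) := fun j =>
    (isSmooth_vel_div hθs hus (hE.temperature_pos t ht) j).isContDiff (by simp)
  have hL41 : Torus.IsContDiff 1 (fun y => -(θ t y)⁻¹) := (isSmooth_neg_inv hθs (hE.temperature_pos t ht)).isContDiff (by simp)
  -- gradients in coordinates
  simp only [gradient_apply_eq_partialDeriv hL01, gradient_apply_eq_partialDeriv (hLj1 _), gradient_apply_eq_partialDeriv hL41]
  -- `|u|²` in coordinates
  have hnorm : ∀ (s : ℝ) (y : T3), ‖u s y‖ ^ 2 = (u s y 0) ^ 2 + (u s y 1) ^ 2 + (u s y 2) ^ 2 := fun s y => by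
    simp only [EuclideanSpace.norm_sq_eq, Fin.sum_univ_three, Real.norm_eq_abs, sq_abs]
  simp only [hnorm, totalEnergyDensity, hsPressure]
  -- (1) first derivatives of `log a = log (ρ Rf(σ³ρ))` at `(t, x)` by the chain rule
  have sA : HasDerivWithinAt (fun τ => Real.log (ρ τ x * Rf (σ ^ 3 * ρ τ x)))
      (Torus.timeDerivWithin (Ico 0 T) ρ t x / ρ t x +
        deriv (fun z => Real.log (Rf z)) (ρ t x * σ ^ 3) * (σ ^ 3 * Torus.timeDerivWithin (Ico 0 T) ρ t x))
      (Ico 0 T) t := by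
    have h2 : HasDerivWithinAt (fun τ => Real.log (Rf (σ ^ 3 * ρ τ x)))
        (deriv (fun z => Real.log (Rf z)) (ρ t x * σ ^ 3) * (σ ^ 3 * Torus.timeDerivWithin (Ico 0 T) ρ t x))
        (Ico 0 T) t :=
      hRd.hasDerivAt.comp_hasDerivWithinAt_of_eq t (sρ.const_mul (σ ^ 3)) (mul_comm _ _)
    exact ((sρ.log (hρ0' t ht)).fun_add h2).congr_of_mem
      (fun τ hτ => Real.log_mul (hρ0' τ hτ) (hR0' τ hτ)) ht
  have cA : ∀ k, HasDerivAt (fun s : ℝ =>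
      Real.log (ρ t (x + Torus.proj (s • EuclideanSpace.single k (1 : ℝ))) *
        Rf (σ ^ 3 * ρ t (x + Torus.proj (s • EuclideanSpace.single k (1 : ℝ))))))
      (Torus.partialDeriv k (ρ t) x / ρ t x +
        deriv (fun z => Real.log (Rf z)) (ρ t x * σ ^ 3) * (σ ^ 3 * Torus.partialDeriv k (ρ t) x)) 0 := by
    intro k
    have h2 : HasDerivAt (fun s : ℝ =>
        Real.log (Rf (σ ^ 3 * ρ t (x + Torus.proj (s • EuclideanSpace.single k (1 : ℝ))))))
        (deriv (fun z => Real.log (Rf z)) (ρ t x * σ ^ 3) * (σ ^ 3 * Torus.partialDeriv k (ρ t) x)) 0 :=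
      hRd.hasDerivAt.comp_of_eq (0 : ℝ) ((cρ k).const_mul (σ ^ 3))
        (by simp only [zero_smul, Torus.proj_zero, add_zero]; ring)
    have hev : (fun s : ℝ =>
        Real.log (ρ t (x + Torus.proj (s • EuclideanSpace.single k (1 : ℝ))) *
          Rf (σ ^ 3 * ρ t (x + Torus.proj (s • EuclideanSpace.single k (1 : ℝ)))))) =ᶠ[𝓝 0]
        fun s => Real.log (ρ t (x + Torus.proj (s • EuclideanSpace.single k (1 : ℝ)))) +
          Real.log (Rf (σ ^ 3 * ρ t (x + Torus.proj (s • EuclideanSpace.single k (1 : ℝ))))) :=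
      Eventually.of_forall fun s => Real.log_mul (hρ0 _) (hR0 _)
    refine ((((cρ k).log (hρ0 _)).fun_add h2).congr_of_eventuallyEq hev).congr_deriv ?_
    simp only [zero_smul, Torus.proj_zero, add_zero]
  -- (2) the time derivatives of `λ⁰, λʲ, λ⁴`
  have hT0 : Torus.timeDerivWithin (Ico 0 T) (fun t' y => Real.log (ρ t' y * Rf (σ ^ 3 * ρ t' y)) -
      3 / 2 * Real.log (2 * Real.pi * θ t' y) -
      ((u t' y 0) ^ 2 + (u t' y 1) ^ 2 + (u t' y 2) ^ 2) / (2 * θ t' y)) t x =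
      (Torus.timeDerivWithin (Ico 0 T) ρ t x / ρ t x +
        deriv (fun z => Real.log (Rf z)) (ρ t x * σ ^ 3) * (σ ^ 3 * Torus.timeDerivWithin (Ico 0 T) ρ t x)) -
        3 / 2 * Torus.timeDerivWithin (Ico 0 T) θ t x / θ t x -
        (u t x 0 * Torus.timeDerivWithin (Ico 0 T) (fun s y => u s y 0) t x +
          u t x 1 * Torus.timeDerivWithin (Ico 0 T) (fun s y => u s y 1) t x +
          u t x 2 * Torus.timeDerivWithin (Ico 0 T) (fun s y => u s y 2) t x) / θ t x +
        ((u t x 0) ^ 2 + (u t x 1) ^ 2 + (u t x 2) ^ 2) *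
          Torus.timeDerivWithin (Ico 0 T) θ t x / (2 * θ t x ^ 2) := by
    refine timeDerivWithin_eq_of_hasDerivWithinAt (((sA.fun_sub
      (((sθ.const_mul (2 * Real.pi)).log (h2πθ0 x)).const_mul (3 / 2))).fun_sub
      (((((su 0).fun_pow 2).fun_add ((su 1).fun_pow 2)).fun_add
        ((su 2).fun_pow 2)).fun_div (sθ.const_mul 2) (h2θ0 x))).congr_deriv ?_) (hU t ht)
    field_simp
    ring
  have hTj : ∀ j, Torus.timeDerivWithin (Ico 0 T) (fun t' y => u t' y j / θ t' y) t x =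
      Torus.timeDerivWithin (Ico 0 T) (fun s y => u s y j) t x / θ t x -
        u t x j * Torus.timeDerivWithin (Ico 0 T) θ t x / θ t x ^ 2 := by
    intro j
    refine timeDerivWithin_eq_of_hasDerivWithinAt (((su j).fun_div sθ hθx).congr_deriv ?_) (hU t ht)
    field_simp
  have hT4 : Torus.timeDerivWithin (Ico 0 T) (fun t' y => -(θ t' y)⁻¹) t x =
      Torus.timeDerivWithin (Ico 0 T) θ t x / θ t x ^ 2 := by
    refine timeDerivWithin_eq_of_hasDerivWithinAt (((sθ.fun_inv hθx).fun_neg).congr_deriv ?_) (hU t ht)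
    field_simp
  -- (3) the partial derivatives of `λ⁰, λʲ, λ⁴`
  have hX0 : ∀ k, Torus.partialDeriv k (fun y => Real.log (ρ t y * Rf (σ ^ 3 * ρ t y)) -
      3 / 2 * Real.log (2 * Real.pi * θ t y) -
      ((u t y 0) ^ 2 + (u t y 1) ^ 2 + (u t y 2) ^ 2) / (2 * θ t y)) x =
      (Torus.partialDeriv k (ρ t) x / ρ t x +
        deriv (fun z => Real.log (Rf z)) (ρ t x * σ ^ 3) * (σ ^ 3 * Torus.partialDeriv k (ρ t) x)) -
        3 / 2 * Torus.partialDeriv k (θ t) x / θ t x -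
        (u t x 0 * Torus.partialDeriv k (fun y => u t y 0) x +
          u t x 1 * Torus.partialDeriv k (fun y => u t y 1) x +
          u t x 2 * Torus.partialDeriv k (fun y => u t y 2) x) / θ t x +
        ((u t x 0) ^ 2 + (u t x 1) ^ 2 + (u t x 2) ^ 2) *
          Torus.partialDeriv k (θ t) x / (2 * θ t x ^ 2) := by
    intro k
    refine partialDeriv_eq_of_hasDerivAt ((((cA k).fun_sub
      ((((cθ k).const_mul (2 * Real.pi)).log (h2πθ0 _)).const_mul (3 / 2))).fun_sub
      (((((cu k 0).fun_pow 2).fun_add ((cu k 1).fun_pow 2)).fun_add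
        ((cu k 2).fun_pow 2)).fun_div ((cθ k).const_mul 2) (h2θ0 _))).congr_deriv ?_)
    simp only [zero_smul, Torus.proj_zero, add_zero]
    field_simp
    ring
  have hXj : ∀ k j, Torus.partialDeriv k (fun y => u t y j / θ t y) x =
      Torus.partialDeriv k (fun y => u t y j) x / θ t x - u t x j * Torus.partialDeriv k (θ t) x / θ t x ^ 2 := by
    intro k j
    refine partialDeriv_eq_of_hasDerivAt (((cu k j).fun_div (cθ k) (hθ0 _)).congr_deriv ?_)
    simp only [zero_smul, Torus.proj_zero, add_zero]
    field_simp
  have hX4 : ∀ k, Torus.partialDeriv k (fun y => -(θ t y)⁻¹) x = Torus.partialDeriv k (θ t) x / θ t x ^ 2 := by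
    intro k
    refine partialDeriv_eq_of_hasDerivAt ((((cθ k).fun_inv (hθ0 _)).fun_neg).congr_deriv ?_)
    simp only [zero_smul, Torus.proj_zero, add_zero]
    field_simp
  -- (4) the primitive equations
  have hP1 := hE.timeDeriv_density_eq ht x
  have hP2 := fun j => hE.density_mul_timeDeriv_velocity_eq hJ hζs (fun s hs y => hρσ s hs y) hp ht x j
  have hP3 := hE.timeDeriv_temperature_eq hJ hζs (fun s hs y => hρσ s hs y) hp ht x
  have hut : ∀ j, Torus.timeDerivWithin (Ico 0 T) (fun s y => u s y j) t x =
      (-(ρ t x * ∑ i, u t x i * Torus.partialDeriv i (fun y => u t y j) x) -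
        (θ t x * ((fun r => hsCompressibility (r * σ ^ 3)) (ρ t x) +
          ρ t x * deriv (fun r => hsCompressibility (r * σ ^ 3)) (ρ t x)) * Torus.partialDeriv j (ρ t) x +
          ρ t x * (fun r => hsCompressibility (r * σ ^ 3)) (ρ t x) * Torus.partialDeriv j (θ t) x)) / ρ t x :=
    fun j => eq_div_of_mul_eq hρx ((mul_comm _ _).trans (hP2 j))
  simp only [Fin.sum_univ_three] at hP1 hP3 hut
  -- (5) assemble: everything is now a rational identity in the point values
  rw [hT0, hT4]
  simp only [Fin.sum_univ_three, hTj, hX0, hXj, hX4, Fin.isValue, Fin.reduceEq, if_true, if_false]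
  rw [hP3, hut 0, hut 1, hut 2, hP1]
  simp only [hζ', hZ', hZη, hRd']
  field_simp
  ring

/-- **The time derivative of the local-Gibbs exponent splits along the entropy variables**: for the explicit
reference activity `a = ρ Rf(σ³ρ)` (`Rf` smooth and positive on the packing window), at every `(t, x)` and frozen
velocity `v`, `∂ₜ g(·, x, v) = ∂ₜλ⁰ + Σ_j v_j ∂ₜλʲ + (‖v‖²/2) ∂ₜλ⁴` (one-sided time derivatives within `[0, T)`;
`g` is affine in `(1, v, ‖v‖²/2)`, `gExp_eq_affine`, and each coefficient is jointly smooth). -/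
theorem timeDeriv_gExp_eq_affine (hE : IsHardSphereEulerSolution σ T ρ u θ)
    (hRf : ∀ η ∈ Ioo 0 η₁, 0 < Rf η ∧ DifferentiableAt ℝ (fun x => Real.log (Rf x)) η ∧
      deriv (fun x => Real.log (Rf x)) η = 2 * deriv F η + η * deriv (deriv F) η)
    (hRfs : ContDiffOn ℝ (⊤ : ℕ∞) Rf (Ioo 0 η₁))
    (hρσ : ∀ t ∈ Ico 0 T, ∀ x, ρ t x * σ ^ 3 ∈ Ioo 0 η₁) {t : ℝ} (ht : t ∈ Ico 0 T) (x : T3) (v : V3) :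
    Torus.timeDerivWithin (Ico 0 T) (fun t' y => Real.log (ρ t' y * Rf (σ ^ 3 * ρ t' y)) -
        3 / 2 * Real.log (2 * Real.pi * θ t' y) - ‖v - u t' y‖ ^ 2 / (2 * θ t' y)) t x =
      Torus.timeDerivWithin (Ico 0 T) (fun t' y => Real.log (ρ t' y * Rf (σ ^ 3 * ρ t' y)) -
          3 / 2 * Real.log (2 * Real.pi * θ t' y) - ‖u t' y‖ ^ 2 / (2 * θ t' y)) t x +
        (∑ j, v j * Torus.timeDerivWithin (Ico 0 T) (fun t' y => u t' y j / θ t' y) t x) +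
        ‖v‖ ^ 2 / 2 * Torus.timeDerivWithin (Ico 0 T) (fun t' y => -(θ t' y)⁻¹) t x := by
  have hU : UniqueDiffOn ℝ (Ico (0 : ℝ) T) := uniqueDiffOn_Ico 0 T
  have hpos : ∀ p ∈ Ico 0 T ×ˢ (univ : Set (EuclideanSpace ℝ (Fin 3))), 0 < Torus.stLift θ p :=
    fun p hp => hE.temperature_pos p.1 (mem_prod.1 hp).1 _
  -- the activity `a = ρ Rf(σ³ρ)` is jointly smooth and positive on `[0, T)`
  have hRa : Torus.IsSmoothSpaceTimeOn (Ico 0 T) (fun s y => Rf (σ ^ 3 * ρ s y)) := by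
    refine hRfs.comp (contDiffOn_const.mul hE.smooth_density) ?_
    rintro ⟨s, w⟩ hq
    show σ ^ 3 * ρ s _ ∈ Ioo 0 η₁
    rw [mul_comm]; exact hρσ s (mem_prod.1 hq).1 _
  have ha : Torus.IsSmoothSpaceTimeOn (Ico 0 T) (fun s y => ρ s y * Rf (σ ^ 3 * ρ s y)) := hE.smooth_density.mul hRa
  have ha0 : ∀ s ∈ Ico 0 T, ∀ y, 0 < ρ s y * Rf (σ ^ 3 * ρ s y) := fun s hs y =>
    mul_pos (hE.density_pos s hs y) (hRf _ (by rw [mul_comm]; exact hρσ s hs y)).1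
  -- the three coefficient fields are jointly smooth
  have hL0 : Torus.IsSmoothSpaceTimeOn (Ico 0 T) (fun t' y => Real.log (ρ t' y * Rf (σ ^ 3 * ρ t' y)) -
      3 / 2 * Real.log (2 * Real.pi * θ t' y) - ‖u t' y‖ ^ 2 / (2 * θ t' y)) := by
    refine ((ContDiffOn.log ha fun p hp => (ha0 p.1 (mem_prod.1 hp).1 _).ne').sub (contDiffOn_const.mul
      ((contDiffOn_const.mul hE.smooth_temperature).log fun p hp => ?_))).sub
      ((hE.smooth_velocity.norm_sq ℝ).div (contDiffOn_const.mul hE.smooth_temperature) fun p hp => ?_)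
    · exact (mul_pos Real.two_pi_pos (hpos p hp)).ne'
    · exact mul_ne_zero two_ne_zero (hpos p hp).ne'
  have hLj : ∀ j, Torus.IsSmoothSpaceTimeOn (Ico 0 T) (fun t' y => u t' y j / θ t' y) := fun j =>
    ContDiffOn.div (hE.smooth_velocity.apply j) hE.smooth_temperature fun p hp => (hpos p hp).ne'
  have hL4 : Torus.IsSmoothSpaceTimeOn (Ico 0 T) (fun t' y => -(θ t' y)⁻¹) :=
    ContDiffOn.neg (ContDiffOn.inv hE.smooth_temperature fun p hp => (hpos p hp).ne')
  have hsum := ((hL0.hasDerivWithinAt_slice ht x).fun_add (HasDerivWithinAt.fun_sum fun j (_ : j ∈ Finset.univ) =>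
    ((hLj j).hasDerivWithinAt_slice ht x).const_mul (v j))).fun_add ((hL4.hasDerivWithinAt_slice ht x).const_mul (‖v‖ ^ 2 / 2))
  refine timeDerivWithin_eq_of_hasDerivWithinAt (hsum.congr_of_mem (fun τ hτ => ?_) ht) (hU t ht)
  exact gExp_eq_affine (a := fun y => ρ τ y * Rf (σ ^ 3 * ρ τ y)) (θ := θ τ) (u := u τ) (hE.temperature_pos τ hτ) x v

/-- **The time derivative of the local-Gibbs exponent is minus the linearised tested Euler flux** (S8 read
coefficient-wise in `v`; plan § 1 D): for the reference activity `a = ρ Rf(σ³ρ)` under the hypotheses of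
`EulerCancellation`, at every `(t, x)` and frozen velocity `v`,
`∂ₜ g_t(x, v) = −Σ_k [∂_kλ⁰ δF⁰_k + Σ_j ∂_kλʲ δFᵐ_{kj} + ∂_kλ⁴ δFᵉ_k]` with `δF = DF(U_t(x)) · (1, v, ‖v‖²/2)` the
derivative of the hs-Euler flux at the Euler state in the direction of the one-particle conserved vector
`η(v) = (1, v, ‖v‖²/2)` (`timeDeriv_gExp_eq_affine` + `eulerStructure_entropyVariables`). -/
theorem timeDeriv_gExp_eq_neg_linearisedFlux (hE : IsHardSphereEulerSolution σ T ρ u θ)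
    (hF : AnalyticOnNhd ℝ F (Ioo (-η₁) η₁))
    (hZ : ∀ η ∈ Ioo 0 η₁, hsCompressibility η = 1 + η * deriv F η)
    (hRf : ∀ η ∈ Ioo 0 η₁, 0 < Rf η ∧ DifferentiableAt ℝ (fun x => Real.log (Rf x)) η ∧
      deriv (fun x => Real.log (Rf x)) η = 2 * deriv F η + η * deriv (deriv F) η)
    (hRfs : ContDiffOn ℝ (⊤ : ℕ∞) Rf (Ioo 0 η₁))
    (hρσ : ∀ t ∈ Ico 0 T, ∀ x, ρ t x * σ ^ 3 ∈ Ioo 0 η₁) {t : ℝ} (ht : t ∈ Ico 0 T) (x : T3) (v : V3) :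
    (let lam0 : ℝ → T3 → ℝ := fun t' y =>
       Real.log (ρ t' y * Rf (σ ^ 3 * ρ t' y)) - 3 / 2 * Real.log (2 * Real.pi * θ t' y) - ‖u t' y‖ ^ 2 / (2 * θ t' y)
     let lam : Fin 3 → ℝ → T3 → ℝ := fun j t' y => u t' y j / θ t' y
     let lam4 : ℝ → T3 → ℝ := fun t' y => -(θ t' y)⁻¹
     let ρ₀ : ℝ := ρ t x
     let u₀ : V3 := u t x
     let θ₀ : ℝ := θ t x
     let Z : ℝ := hsCompressibility (ρ₀ * σ ^ 3)
     let Z' : ℝ := deriv hsCompressibility (ρ₀ * σ ^ 3)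
     let p : ℝ := hsPressure σ ρ₀ θ₀
     let E : ℝ := totalEnergyDensity ρ₀ u₀ θ₀
     let δρ : ℝ := 1
     let δm : V3 := v
     let δE : ℝ := ‖v‖ ^ 2 / 2
     let δu : Fin 3 → ℝ := fun k => (δm k - u₀ k * δρ) / ρ₀
     let δp : ℝ := 2 / 3 * Z * (δE - (∑ j, u₀ j * δm j) + ‖u₀‖ ^ 2 / 2 * δρ) + θ₀ * (ρ₀ * σ ^ 3) * Z' * δρ
     let δF0 : Fin 3 → ℝ := fun k => δm k
     let δFm : Fin 3 → Fin 3 → ℝ := fun k j =>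
       u₀ j * δm k + u₀ k * δm j - u₀ k * u₀ j * δρ + (if k = j then δp else 0)
     let δFe : Fin 3 → ℝ := fun k => (E + p) * δu k + u₀ k * (δE + δp)
     Torus.timeDerivWithin (Ico 0 T) (fun t' y => Real.log (ρ t' y * Rf (σ ^ 3 * ρ t' y)) -
         3 / 2 * Real.log (2 * Real.pi * θ t' y) - ‖v - u t' y‖ ^ 2 / (2 * θ t' y)) t x =
       -∑ k, (Torus.gradient (lam0 t) x k * δF0 k + (∑ j, Torus.gradient (lam j t) x k * δFm k j) +
         Torus.gradient (lam4 t) x k * δFe k)) := by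
  dsimp only
  have h1 := timeDeriv_gExp_eq_affine hE hRf hRfs hρσ ht x v
  have h2 := eulerStructure_entropyVariables hE hF hZ hRf hRfs hρσ ht x 1 (‖v‖ ^ 2 / 2) v
  dsimp only at h2
  rw [h1]
  simp only [Fin.sum_univ_three] at h2 ⊢
  linear_combination h2

end EulerStructure

/-! ## The registered helper stub -/

/-- **Registered helper stub `stub_windowClauseEulerStructure` (plan § 1 D of stub 4a-ii, skeleton v8, crux stmt-17740)**:
sorry-free conjunction of `eulerStructure_entropyVariables` (§ 1) and `contDiffOn_of_hasFPowerSeriesOnBall` (§ 0), restated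
with fully qualified names (the registered one-line signature; `timeDeriv_gExp_eq_affine` / `…_neg_linearisedFlux` are its
corollaries in this file). -/
theorem stub_windowClauseEulerStructure : (∀ (σ T η₁ : ℝ) (ρ θ : ℝ → Literature.MathematicalPhysics.KineticTheory.T3 → ℝ) (u : ℝ → Literature.MathematicalPhysics.KineticTheory.T3 → Literature.MathematicalPhysics.KineticTheory.V3) (F Rf : ℝ → ℝ), Literature.MathematicalPhysics.KineticTheory.IsHardSphereEulerSolution σ T ρ u θ → AnalyticOnNhd ℝ F (Set.Ioo (-η₁) η₁) → (∀ η ∈ Set.Ioo 0 η₁, Literature.MathematicalPhysics.KineticTheory.hsCompressibility η = 1 + η * deriv F η) → (∀ η ∈ Set.Ioo 0 η₁, 0 < Rf η ∧ DifferentiableAt ℝ (fun x => Real.log (Rf x)) η ∧ deriv (fun x => Real.log (Rf x)) η = 2 * deriv F η + η * deriv (deriv F) η) → ContDiffOn ℝ (⊤ : ℕ∞) Rf (Set.Ioo 0 η₁) → (∀ t ∈ Set.Ico 0 T, ∀ x, ρ t x * σ ^ 3 ∈ Set.Ioo 0 η₁) → ∀ t ∈ Set.Ico 0 T, ∀ (x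 : Literature.MathematicalPhysics.KineticTheory.T3) (δρ δE : ℝ) (δm : Literature.MathematicalPhysics.KineticTheory.V3), (let lam0 : ℝ → Literature.MathematicalPhysics.KineticTheory.T3 → ℝ := fun t' y => Real.log (ρ t' y * Rf (σ ^ 3 * ρ t' y)) - 3 / 2 * Real.log (2 * Real.pi * θ t' y) - ‖u t' y‖ ^ 2 / (2 * θ t' y); let lam : Fin 3 → ℝ → Literature.MathematicalPhysics.KineticTheory.T3 → ℝ := fun j t' y => u t' y j / θ t' y; let lam4 : ℝ → Literature.MathematicalPhysics.KineticTheory.T3 → ℝ := fun t' y => -(θ t' y)⁻¹; let ρ₀ : ℝ := ρ t x; let u₀ : Literature.MathematicalPhysics.KineticTheory.V3 := u t x; let θ₀ : ℝ := θ t x; let Z : ℝ := Literature.MathematicalPhysics.KineticTheory.hsCompressibility (ρ₀ * σ ^ 3); let Z' : ℝ := deriv Literature.MathematicalPhysics.KineticTheory.hsCompressibility (ρ₀ * σ ^ 3); let p : ℝ := Literature.MathematicalPhysics.KineticTheory.hsPressure σ ρ₀ θ₀; let E : ℝ := Literature.MathematicalPhysics.KineticTheory.totalEnergyDensity ρ₀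 u₀ θ₀; let δu : Fin 3 → ℝ := fun k => (δm k - u₀ k * δρ) / ρ₀; let δp : ℝ := 2 / 3 * Z * (δE - (∑ j, u₀ j * δm j) + ‖u₀‖ ^ 2 / 2 * δρ) + θ₀ * (ρ₀ * σ ^ 3) * Z' * δρ; let δF0 : Fin 3 → ℝ := fun k => δm k; let δFm : Fin 3 → Fin 3 → ℝ := fun k j => u₀ j * δm k + u₀ k * δm j - u₀ k * u₀ j * δρ + (if k = j then δp else 0); let δFe : Fin 3 → ℝ := fun k => (E + p) * δu k + u₀ k * (δE + δp); Literature.Analysis.FunctionSpaces.Torus.timeDerivWithin (Set.Ico 0 T) lam0 t x * δρ + (∑ j, Literature.Analysis.FunctionSpaces.Torus.timeDerivWithin (Set.Ico 0 T) (lam j) t x * δm j) + Literature.Analysis.FunctionSpaces.Torus.timeDerivWithin (Set.Ico 0 T) lam4 t x * δE + ∑ k, (Literature.Analysis.FunctionSpaces.Torus.gradient (lam0 t) x k * δF0 k + (∑ j, Literature.Analysis.FunctionSpaces.Torus.gradient (lam j t) x k * δFm k j) + Literature.Analysis.FunctionSpaces.Torus.gradient (lam4 t) x k * δFe k) = 0))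 ∧ (∀ (r η₁ : ℝ) (Rf : ℝ → ℝ), (∃ p : FormalMultilinearSeries ℝ ℝ ℝ, HasFPowerSeriesOnBall Rf p 0 (ENNReal.ofReal r)) → η₁ ≤ r → ContDiffOn ℝ (⊤ : ℕ∞) Rf (Set.Ioo 0 η₁)) :=
  ⟨fun _ _ _ _ _ _ _ _ hE hF hZ hRf hRfs hρσ _ ht x δρ δE δm =>
      eulerStructure_entropyVariables hE hF hZ hRf hRfs hρσ ht x δρ δE δm,
    fun _ _ _ hana hle => contDiffOn_of_hasFPowerSeriesOnBall hana hle⟩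

end Summit.AtomisticToContinuum.HydrodynamicLimit.Theorems.LTEInBand

end
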